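/-
Copyright (c) 2026. All rights reserved.
Released under Apache 2.0 license as described in the file LICENSE.
-/
import Summits.AtomisticToContinuum.Crystallization.Theorems.ChartedZeroExcessLayeredLatticeLiouvilleVU

/-!
# ChartedZeroExcessLayeredLatticeLiouville — part VV «ModeExtraction»: brick (3) MODE EXTRACTION of the modal-Lipschitz leaf, typed VERBATIM as the
  g57 statement of record `ModeExtractionShape` and PROVED (decomp-a2c-lens-2, g58; helper of stmt-AtomisticToContinuum-26636, leaf (LD′) `ModalLipschitzZ`)

THE THEOREM.  ★★★ `modeExtractionShape_holds : ModeExtractionShape` — under the tail certificate `TailDominationCert` (one named hypothesis, as in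
`ModalLipschitzZ`): for every `κ₀ > 0`, `c₀ > 0` there are `C ≥ 1` and `ϱ₁ ≥ 1` such that for EVERY range `ϱ ≥ ϱ₁`, every `c₀`-co-Lipschitz
`κ₀`-coercive layered crystal `(a, b, w)` (any stacking word), every slope `g : Fin 2 → E3` and every flux vector `F : E3` there is a profile
`cf : ℤ → E3` with (i) the affine-plus-profile field `modeField g cf = (γ, α) ↦ Σ_j γ_j g j + cf α` range-`ϱ` TRUNCATED-HARMONIC on all of `ℤ² × ℤ`,
(ii) prescribed column flux `columnFlux ϱ a b w ⌊ϱ/c₀⌋ g cf m = F` through EVERY gap `m`, and (iii) the chain-Lipschitz bound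
`‖cf (α+1) − cf α‖ ≤ C·(‖g 0‖ + ‖g 1‖ + ‖F‖)` with `C = C(κ₀, c₀)` WORD-UNIFORM and `ϱ`-UNIFORM (chosen before `ϱ`; critic row 938 (a)).

THE PROOF (parts VP–VU assembled).  Take `ε := κ₀` in the tail certificate (`ϱ₀(c₀, κ₀)`), so for `ϱ ≥ ϱ₁ := max 1 ϱ₀` the window lemma VS
`flux_window_solve` applies with `δ = κ₀/2`: on every window `[-L, L]` the banded flux-block system `Σ_k fluxBlock m k (d k) = h m` is solvable with
`‖d‖_∞ ≤ modeConst c₀ (κ₀/2)·‖h‖_∞`.  `flux_global_solve`: let `L → ∞` along the free ultrafilter `Filter.hyperfilter ℕ` — the coordinates are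
uniformly bounded, so each converges (`exists_limit_field`, compactness of closed balls of `E3`), every banded gap equation involves finitely many
coordinates and holds on `[-L, L]` as soon as `L ≥ |m| + ⌊ϱ/c₀⌋` (VP `fluxBlock_eq_zero_of_not_mem`), hence passes to the limit, and so does the
bound.  `flux_profile_solve`: the two-sided primitive `biPrim d` has increments `d` (so the chain-Lipschitz bound is the coordinate bound) and chain
flux `h` (VP `chainFlux_eq_sum_fluxBlock`).  `mode_extraction`: with the datum `h m := F − boxSlope m`, bounded by `‖F‖ + 441·F(c₀)·(‖g 0‖ + ‖g 1‖)`
UNIFORMLY (VU `norm_boxSlope_le`), the column flux is `chainFlux + boxSlope = F` (VT `columnFlux_eq`, VP `chainFlux_eq_box`) and the mode field is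
truncated-harmonic (VT `isTruncHarmonicZ_modeField_of_columnFlux`).  Constant: `C = max 1 (modeConst c₀ (κ₀/2) · max 1 (441·kernelConst c₀))`,
`modeConst c δ = 10(⌊1176·kernelConst c/δ⌋ + 1)/δ`.
-/

namespace Summit.AtomisticToContinuum.Crystallization.Theorems.ChartedZeroExcessLayeredLatticeLiouville

open Summit.AtomisticToContinuum.Crystallization.Theorems.ChartedPlanarOrderRigidityDoor (E3)
open Finset
open scoped InnerProductSpace RealInnerProductSpace BigOperators

noncomputable section ModeExtraction

variable {c : ℝ} {a b : E3} {w : ℤ → E3}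

/-! ### VV.1  The two-sided primitive of an increment field -/

/-- the TWO-SIDED PRIMITIVE of an increment field `d` on `ℤ`, normalised at `0`: `Σ_{0 ≤ k < n} d k` for `n ≥ 0` and `−Σ_{n ≤ k < 0} d k` for `n < 0`.
[this file, g58] -/
def biPrim (d : ℤ → E3) (n : ℤ) : E3 :=
  (∑ k ∈ Ico 0 n, d k) - ∑ k ∈ Ico n 0, d k

/-- the increments of the two-sided primitive are the field, EVERYWHERE on `ℤ`. [formal bookkeeping] -/
theorem biPrim_succ_sub (d : ℤ → E3) (n : ℤ) : biPrim d (n + 1) - biPrim d n = d n := by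
  unfold biPrim
  have h3 : Ico n (n + 1) = {n} := by
    ext x
    rw [mem_Ico, mem_singleton]
    omega
  rcases le_or_gt 0 n with h | h
  · have h1 : Ico n 0 = ∅ := Ico_eq_empty_of_le h
    have h2 : Ico (n + 1) 0 = ∅ := Ico_eq_empty_of_le (by omega)
    rw [h1, h2, sum_empty, sub_zero, sub_zero, ← Ico_union_Ico_eq_Ico h (by omega : n ≤ n + 1),
      sum_union (Ico_disjoint_Ico_consecutive _ _ _), h3, sum_singleton, add_sub_cancel_left]
  · have h1 : Ico 0 (n + 1) = ∅ := Ico_eq_empty_of_le (by omega)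
    have h2 : Ico 0 n = ∅ := Ico_eq_empty_of_le (by omega)
    rw [h1, h2, sum_empty, zero_sub, zero_sub, ← Ico_union_Ico_eq_Ico (by omega : n ≤ n + 1) (by omega : n + 1 ≤ 0),
      sum_union (Ico_disjoint_Ico_consecutive _ _ _), h3, sum_singleton, neg_sub_neg, add_sub_cancel_right]

/-! ### VV.2  Coordinatewise limits of a uniformly bounded sequence of fields along the free ultrafilter -/

/-- COORDINATEWISE LIMITS: a uniformly bounded sequence of fields `d L : ℤ → E3` has, along the free ultrafilter `Filter.hyperfilter ℕ`, a limit in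
every coordinate, with the same bound (compactness of the closed balls of `E3`). [this file, g58] -/
theorem exists_limit_field {R : ℝ} (d : ℕ → ℤ → E3) (hd : ∀ L m, ‖d L m‖ ≤ R) :
    ∃ dinf : ℤ → E3, (∀ m, ‖dinf m‖ ≤ R) ∧
      ∀ m, Filter.Tendsto (fun L => d L m) (Filter.hyperfilter ℕ : Filter ℕ) (nhds (dinf m)) := by
  have hex : ∀ m : ℤ, ∃ x ∈ Metric.closedBall (0 : E3) R,
      (((Filter.hyperfilter ℕ).map fun L => d L m : Ultrafilter E3) : Filter E3) ≤ nhds x := fun m => by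
    refine (isCompact_closedBall (0 : E3) R).ultrafilter_le_nhds _ (Filter.le_principal_iff.mpr ?_)
    rw [Ultrafilter.coe_map]
    exact Filter.mem_map.mpr (Filter.univ_mem' fun L => mem_closedBall_zero_iff.mpr (hd L m))
  choose dinf hmem hle using hex
  refine ⟨dinf, fun m => mem_closedBall_zero_iff.mp (hmem m), fun m => ?_⟩
  have h := hle m
  rw [Ultrafilter.coe_map] at h
  exact h

/-! ### VV.3  ★★ The global banded flux-block system -/

/-- ★★ THE GLOBAL FLUX-BLOCK SYSTEM: under the tail certificate (`ε < 2κ₀`) the banded system `Σ_{|k−m| ≤ ⌊ϱ/c⌋} fluxBlock m k (d k) = h m`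
(ALL gaps `m ∈ ℤ`) has, for every bounded datum `‖h‖_∞ ≤ H`, a solution with `‖d‖_∞ ≤ modeConst c (κ₀ − ε/2)·H` — the limit along the free
ultrafilter of the VS window solutions on `[-L, L]`, every banded gap equation and the coordinate bound passing to the limit. [this file, g58] -/
theorem flux_global_solve (hc : 0 < c) (hL : IsLayeredCrystal c a b w) {κ₀ ε ϱ : ℝ} (hϱ : 0 ≤ ϱ) (hε : ε < 2 * κ₀)
    (hK : CoerciveZ (layeredKernel a b w) κ₀)
    (hT : ∀ φ : Cell 2 → ℤ → E3, HasFiniteSupport φ → Summable (tailFam ϱ a b w φ) ∧ ∑' x, tailFam ϱ a b w φ x ≤ ε * nnFormZ φ)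
    (h : ℤ → E3) {H : ℝ} (hH : ∀ m, ‖h m‖ ≤ H) :
    ∃ d : ℤ → E3, (∀ m : ℤ, ∑ k ∈ Icc (m - ⌊ϱ / c⌋₊) (m + ⌊ϱ / c⌋₊), fluxBlock hc hL ϱ m k (d k) = h m) ∧
      ∀ m, ‖d m‖ ≤ modeConst c (κ₀ - ε / 2) * H := by
  choose dW hd0 hdh hdb using fun L : ℕ => flux_window_solve hc hL hϱ hε hK hT (Icc (-(L : ℤ)) L) h fun n _ => hH n
  have hH0 : 0 ≤ H := (norm_nonneg _).trans (hH 0)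
  have hR : ∀ (L : ℕ) (m : ℤ), ‖dW L m‖ ≤ modeConst c (κ₀ - ε / 2) * H := by
    intro L m
    by_cases hm : m ∈ Icc (-(L : ℤ)) L
    · exact hdb L m hm
    · rw [hd0 L m hm, norm_zero]
      exact mul_nonneg (modeConst_nonneg c (by linarith)) hH0
  obtain ⟨d, hdR, hlim⟩ := exists_limit_field dW hR
  refine ⟨d, fun m => ?_, hdR⟩
  have hwin : ∀ L : ℕ, m.natAbs + ⌊ϱ / c⌋₊ ≤ L → ∑ k ∈ Icc (m - ⌊ϱ / c⌋₊) (m + ⌊ϱ / c⌋₊), fluxBlock hc hL ϱ m k (dW L k) = h m := by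
    intro L hLm
    have hmW : m ∈ Icc (-(L : ℤ)) L := by rw [mem_Icc]; omega
    rw [← hdh L m hmW]
    unfold blockApply
    refine sum_eq_sum_of_vanish (fun k hk hkW => ?_) (fun k _ hk => ?_)
    · exfalso
      rw [mem_Icc] at hk
      exact hkW (by rw [mem_Icc]; omega)
    · rw [fluxBlock_eq_zero_of_not_mem hc hL ϱ hk]
      rfl
  have hU : (Filter.hyperfilter ℕ : Filter ℕ) ≤ Filter.atTop := by
    rw [← Nat.cofinite_eq_atTop]
    exact Filter.hyperfilter_le_cofinite
  have hev : Filter.EventuallyEq (Filter.hyperfilter ℕ : Filter ℕ) (fun _ => h m)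
      fun L => ∑ k ∈ Icc (m - ⌊ϱ / c⌋₊) (m + ⌊ϱ / c⌋₊), fluxBlock hc hL ϱ m k (dW L k) :=
    (Filter.eventually_atTop.mpr ⟨m.natAbs + ⌊ϱ / c⌋₊, fun L hL' => (hwin L hL').symm⟩).filter_mono hU
  have h1 : Filter.Tendsto (fun L => ∑ k ∈ Icc (m - ⌊ϱ / c⌋₊) (m + ⌊ϱ / c⌋₊), fluxBlock hc hL ϱ m k (dW L k))
      (Filter.hyperfilter ℕ : Filter ℕ) (nhds (∑ k ∈ Icc (m - ⌊ϱ / c⌋₊) (m + ⌊ϱ / c⌋₊), fluxBlock hc hL ϱ m k (d k))) :=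
    tendsto_finsetSum _ fun k _ => ((fluxBlock hc hL ϱ m k).continuous.tendsto (d k)).comp (hlim k)
  have h2 : Filter.Tendsto (fun L => ∑ k ∈ Icc (m - ⌊ϱ / c⌋₊) (m + ⌊ϱ / c⌋₊), fluxBlock hc hL ϱ m k (dW L k))
      (Filter.hyperfilter ℕ : Filter ℕ) (nhds (h m)) := tendsto_const_nhds.congr' hev
  exact tendsto_nhds_unique h1 h2

/-- ★ THE GLOBAL PROFILE: a chain-Lipschitz profile `cf` (two-sided primitive of the global solution) whose CHAIN FLUX through every gap, on any
carrier containing the band box, is the prescribed bounded datum. [this file, g58] -/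
theorem flux_profile_solve (hc : 0 < c) (hL : IsLayeredCrystal c a b w) {κ₀ ε ϱ : ℝ} (hϱ : 0 ≤ ϱ) (hε : ε < 2 * κ₀)
    (hK : CoerciveZ (layeredKernel a b w) κ₀)
    (hT : ∀ φ : Cell 2 → ℤ → E3, HasFiniteSupport φ → Summable (tailFam ϱ a b w φ) ∧ ∑' x, tailFam ϱ a b w φ x ≤ ε * nnFormZ φ)
    (h : ℤ → E3) {H : ℝ} (hH : ∀ m, ‖h m‖ ≤ H) :
    ∃ cf : ℤ → E3, (∀ (m : ℤ) (T : Finset ℤ), Icc (m - ⌊ϱ / c⌋₊) (m + 1 + ⌊ϱ / c⌋₊) ⊆ T → chainFlux ϱ a b w T cf m = h m) ∧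
      ∀ α : ℤ, ‖cf (α + 1) - cf α‖ ≤ modeConst c (κ₀ - ε / 2) * H := by
  obtain ⟨d, hd, hdb⟩ := flux_global_solve hc hL hϱ hε hK hT h hH
  refine ⟨biPrim d, fun m T hTs => ?_, fun α => by rw [biPrim_succ_sub]; exact hdb α⟩
  rw [chainFlux_eq_sum_fluxBlock hc hL (biPrim d) hTs, ← hd m]
  exact sum_congr rfl fun k _ => by rw [biPrim_succ_sub]

/-! ### VV.4  ★★★ Mode extraction -/

/-- ★★ MODE EXTRACTION at fixed data: under the tail certificate (`ε < 2κ₀`), for every slope `g` and flux vector `F` a profile `cf` with the mode field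
`modeField g cf` truncated-harmonic on all of `ℤ² × ℤ`, column flux `F` through every gap, and chain-Lipschitz constant
`modeConst c (κ₀ − ε/2)·(‖F‖ + 441·F(c)·(‖g 0‖ + ‖g 1‖))` — uniform in `ϱ` and in the stacking word. [this file, g58] -/
theorem mode_extraction (hc : 0 < c) (hL : IsLayeredCrystal c a b w) {κ₀ ε ϱ : ℝ} (hϱ : 0 ≤ ϱ) (hε : ε < 2 * κ₀)
    (hK : CoerciveZ (layeredKernel a b w) κ₀)
    (hT : ∀ φ : Cell 2 → ℤ → E3, HasFiniteSupport φ → Summable (tailFam ϱ a b w φ) ∧ ∑' x, tailFam ϱ a b w φ x ≤ ε * nnFormZ φ)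
    (g : Fin 2 → E3) (F : E3) :
    ∃ cf : ℤ → E3, IsTruncHarmonicZ ϱ a b w (modeField g cf) Set.univ ∧ (∀ m : ℤ, columnFlux ϱ a b w ⌊ϱ / c⌋₊ g cf m = F) ∧
      ∀ α : ℤ, ‖cf (α + 1) - cf α‖ ≤ modeConst c (κ₀ - ε / 2) * (‖F‖ + 441 * kernelConst c * (‖g 0‖ + ‖g 1‖)) := by
  have hH : ∀ m : ℤ, ‖F - boxSlope ϱ a b w ⌊ϱ / c⌋₊ g m‖ ≤ ‖F‖ + 441 * kernelConst c * (‖g 0‖ + ‖g 1‖) := fun m =>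
    (norm_sub_le _ _).trans (by linarith [norm_boxSlope_le hc hL ϱ ⌊ϱ / c⌋₊ g m])
  obtain ⟨cf, hflux, hinc⟩ := flux_profile_solve hc hL hϱ hε hK hT (fun m => F - boxSlope ϱ a b w ⌊ϱ / c⌋₊ g m) hH
  have hcol : ∀ m : ℤ, columnFlux ϱ a b w ⌊ϱ / c⌋₊ g cf m = F := fun m => by
    have e := hflux m _ (Subset.refl (Icc (m - ⌊ϱ / c⌋₊) (m + 1 + ⌊ϱ / c⌋₊)))
    rw [chainFlux_eq_box hc hL cf (Subset.refl _)] at e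
    rw [columnFlux_eq, e]
    exact sub_add_cancel F _
  exact ⟨cf, isTruncHarmonicZ_modeField_of_columnFlux hc hL ϱ g cf hcol, hcol, hinc⟩

/-- (3) MODE EXTRACTION — the statement shape of record (g57 `sketch_ModeExtraction.lean`, VERBATIM): for every slope `g` and flux vector `F` a
chain-Lipschitz profile solving the banded block recursion with the affine source and the prescribed column flux; the constant is WORD-UNIFORM and
`ϱ`-UNIFORM (`∃ C` precedes `∀ ϱ ≥ ϱ₁`, exactly as in `ModalLipschitzZ`). [g57 sketch; this file, g58] -/
def ModeExtractionShape : Prop :=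
  TailDominationCert → ∀ κ₀ > (0 : ℝ), ∀ c₀ > (0 : ℝ), ∃ C ≥ (1 : ℝ), ∃ ϱ₁ ≥ (1 : ℝ), ∀ ϱ ≥ ϱ₁, ∀ (a b : E3) (w : ℤ → E3),
    IsLayeredCrystal c₀ a b w → CoerciveZ (layeredKernel a b w) κ₀ →
      ∀ (g : Fin 2 → E3) (F : E3), ∃ cf : ℤ → E3,
        IsTruncHarmonicZ ϱ a b w (modeField g cf) Set.univ ∧
        (∀ m : ℤ, columnFlux ϱ a b w ⌊ϱ / c₀⌋₊ g cf m = F) ∧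
        ∀ α : ℤ, ‖cf (α + 1) - cf α‖ ≤ C * (‖g 0‖ + ‖g 1‖ + ‖F‖)

/-- ★★★ (3) MODE EXTRACTION HOLDS, with `C(κ₀, c₀) = max 1 (modeConst c₀ (κ₀/2) · max 1 (441·kernelConst c₀))` and `ϱ₁ = max 1 ϱ₀(c₀, κ₀)` from
the tail certificate at `ε = κ₀`. [this file, g58] -/
theorem modeExtractionShape_holds : ModeExtractionShape := by
  intro hTD κ₀ hκ₀ c₀ hc₀
  obtain ⟨ϱ₀, _, hTail⟩ := hTD c₀ hc₀ κ₀ hκ₀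
  refine ⟨max 1 (modeConst c₀ (κ₀ - κ₀ / 2) * max 1 (441 * kernelConst c₀)), le_max_left _ _, max 1 ϱ₀, le_max_left _ _, ?_⟩
  intro ϱ hϱ a b w hL hK g F
  have hϱ0 : 0 ≤ ϱ := zero_le_one.trans ((le_max_left _ _).trans hϱ)
  have hϱ₀ϱ : ϱ₀ ≤ ϱ := (le_max_right _ _).trans hϱ
  have hε : κ₀ < 2 * κ₀ := by linarith
  have hT : ∀ φ : Cell 2 → ℤ → E3, HasFiniteSupport φ →
      Summable (tailFam ϱ a b w φ) ∧ ∑' x, tailFam ϱ a b w φ x ≤ κ₀ * nnFormZ φ :=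
    fun φ hφ => hTail ϱ hϱ₀ϱ a b w hL φ hφ
  obtain ⟨cf, hharm, hcol, hinc⟩ := mode_extraction hc₀ hL hϱ0 hε hK hT g F
  refine ⟨cf, hharm, hcol, fun α => (hinc α).trans ?_⟩
  have hM0 : 0 ≤ modeConst c₀ (κ₀ - κ₀ / 2) := modeConst_nonneg c₀ (by linarith)
  have hF0 := kernelConst_nonneg hc₀
  have hG : 0 ≤ ‖g 0‖ + ‖g 1‖ := by positivity
  have h1 : ‖F‖ + 441 * kernelConst c₀ * (‖g 0‖ + ‖g 1‖) ≤ max 1 (441 * kernelConst c₀) * (‖g 0‖ + ‖g 1‖ + ‖F‖) := by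
    have ha : ‖F‖ ≤ max 1 (441 * kernelConst c₀) * ‖F‖ := le_mul_of_one_le_left (norm_nonneg _) (le_max_left _ _)
    have hb : 441 * kernelConst c₀ * (‖g 0‖ + ‖g 1‖) ≤ max 1 (441 * kernelConst c₀) * (‖g 0‖ + ‖g 1‖) :=
      mul_le_mul_of_nonneg_right (le_max_right _ _) hG
    have hc : max 1 (441 * kernelConst c₀) * (‖g 0‖ + ‖g 1‖ + ‖F‖) =
        max 1 (441 * kernelConst c₀) * (‖g 0‖ + ‖g 1‖) + max 1 (441 * kernelConst c₀) * ‖F‖ := by ring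
    linarith
  calc modeConst c₀ (κ₀ - κ₀ / 2) * (‖F‖ + 441 * kernelConst c₀ * (‖g 0‖ + ‖g 1‖))
      ≤ modeConst c₀ (κ₀ - κ₀ / 2) * (max 1 (441 * kernelConst c₀) * (‖g 0‖ + ‖g 1‖ + ‖F‖)) := mul_le_mul_of_nonneg_left h1 hM0
    _ = modeConst c₀ (κ₀ - κ₀ / 2) * max 1 (441 * kernelConst c₀) * (‖g 0‖ + ‖g 1‖ + ‖F‖) := by ring
    _ ≤ max 1 (modeConst c₀ (κ₀ - κ₀ / 2) * max 1 (441 * kernelConst c₀)) * (‖g 0‖ + ‖g 1‖ + ‖F‖) :=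
        mul_le_mul_of_nonneg_right (le_max_right _ _) (by positivity)

end ModeExtraction

end Summit.AtomisticToContinuum.Crystallization.Theorems.ChartedZeroExcessLayeredLatticeLiouville
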